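import Summits.QuantumFields.YangMills.Theorems.BalabanUVNodesPortS1LZdetTwinObjects
import Summits.QuantumFields.YangMills.Theorems.BalabanUVNodesPortS1LZdetPiecesLocGauge

/-!
# NODE O port PT-A — THE INTEGER POWER-MEMBER FORMULA IS WINDOW-LOCAL AND `SL(2,ℂ)`-INVARIANT (`stub_LZdetTwin` of 27930, line `pta_residueW`): `powTwin F Mc TZY R` as an
# `IntLocalFormula (L^{k+1}·Mc)` from the P0-ℂ body's (Z-loc) and (Z-cov)

Cell `ym-nodeO-ideate`, porter seat `ymgap-nodeO-port-PTA-1` (gen 8); `--supports stmt-QuantumFields-27930` (helper, P0-free).  [I] = [Balaban1987RG1], [16] = [Balaban1985UV3].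
* §1 `intSites_mono`, ★ `isLocal_powTwin` — (Z-loc) entry by entry for the pieces `Ŷ ⊆ X̂` (their windows lie in the window of `X̂`) + ✓`powMemberPiece_congr_of_subset`.
* §2 `twinMat_intGaugeAct`, ★ `isGaugeInv_powTwin` — (Z-cov): the pulled-back (1.10) action conjugates every integer piece matrix by the block-diagonal `D(û) = ⊕_b̂ AdZ û b̂` (invertible), so the
  traces of ordered products — hence `powMemberPiece` (✓`powMemberPiece_conj`) — are invariant.
* §3 ★ `powTwinLocal F Mc k TZY R … : IntLocalFormula (F.L^{k+1}·Mc)` — the bundled object (a `def` assembling the two proofs; its formula is `powTwin` by `rfl`).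

HONEST FRAMING.  Algebra over DISPLAYED clauses of the P0-ℂ body (inhabited nowhere); NOTHING of Bałaban's estimates asserted, ported or discharged; `stub_LZdetTwin` NOT yet closed (the cover bridge is the
companion file `…LZdetTwinBridge`); 27930 OPEN · no claim; NODE O 0∕1; COUNT 8∕28 · K 1∕4 UNMOVED; finite `𝕋⁴_{L^K}` at fixed ε — NOT continuum ∕ OS ∕ Clay; **the Yang–Mills mass gap is NOT proved by any
of this.**  No `sorry`, no `instance`, no `notation`; standard axioms.
-/

noncomputable section

open scoped BigOperators Matrix.Norms.L2Operator
open Finset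

namespace Summit.QuantumFields.YangMills.Theorems.BalabanUVNodesPortS1

open Summit.QuantumFields.YangMills.Theorems.K0RecordFormatNames
open Literature.MathematicalPhysics.QuantumFieldTheory.Balaban1983to89
open Literature.MathematicalPhysics.QuantumFieldTheory.Balaban1983to89.Node00
open Literature.MathematicalPhysics.QuantumFieldTheory.Balaban1983to89.T4Continuum (T4Family)
open Literature.MathematicalPhysics.QuantumFieldTheory.Balaban1983to89.B14.Eq213MaximalDomains (cubeExt)

variable (F : T4Family)

/-! ## §1  Window-locality -/

/-- The integer window of a cube set is monotone in the cube set. [cite: Balaban1987RG1, (1.7) p.261 (bookkeeping)] -/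
theorem intSites_mono (s : ℕ) {Yh Xh : Finset (Fin 4 → ℤ)} (h : Yh ⊆ Xh) : (⋃ a ∈ Yh, cubeExt s a 0) ⊆ ⋃ a ∈ Xh, cubeExt s a 0 :=
  Set.biUnion_subset_biUnion_left fun _ ha => h ha

/-- ★ **`powTwin` IS WINDOW-LOCAL at side `L^{k+1}·Mc`**: two integer configurations agreeing on the bonds inside the window of `X̂` give the same integer pieces `TZY Ŷ`, `Ŷ ⊆ X̂` ((Z-loc), entry by
entry, windows of sub-cube-sets are sub-windows), hence the same power-member formula (✓`powMemberPiece_congr_of_subset`). [cite: Balaban1987RG1, (1.7) p.261, (1.21) p.264] -/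
theorem isLocal_powTwin (Mc k : ℕ)
    (TZY : Finset (Fin 4 → ℤ) → IntBondCfg → ((Fin 4 → ℤ) × Fin 4) × Fin 3 → ((Fin 4 → ℤ) × Fin 4) × Fin 3 → ℂ) (R : ℝ)
    (hZloc : ∀ i j : ((Fin 4 → ℤ) × Fin 4) × Fin 3, IntFormula.IsLocal (F.L ^ (k + 1) * Mc) fun Xh f => TZY Xh f i j) :
    IntFormula.IsLocal (F.L ^ (k + 1) * Mc) (powTwin F Mc TZY R) := by
  classical
  intro Xh f f' hff'
  show powMemberPiece _ (fun Yh : ↥Xh.powerset => twinMat F Mc TZY Xh Yh.1 f) R Xh = powMemberPiece _ (fun Yh : ↥Xh.powerset => twinMat F Mc TZY Xh Yh.1 f') R Xh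
  refine powMemberPiece_congr_of_subset _ (fun Yh hYh => ?_) R
  ext i j
  simp only [twinMat, Matrix.of_apply]
  exact hZloc _ _ Yh.1 f f' fun zμ h1 h2 => hff' zμ (intSites_mono _ hYh h1) (intSites_mono _ hYh h2)

/-! ## §2  `SL(2,ℂ)`-invariance -/

/-- **The pulled-back (1.10) action conjugates the integer piece matrices by the block-diagonal `D(û) = ⊕_b̂ AdZ û b̂`** ((Z-cov) read on the integer fluctuation index of `X̂`).
[cite: Balaban1987RG1, (1.10) p.262, (1.19) p.263] -/
theorem twinMat_intGaugeAct (Mc : ℕ)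
    (TZY : Finset (Fin 4 → ℤ) → IntBondCfg → ((Fin 4 → ℤ) × Fin 4) × Fin 3 → ((Fin 4 → ℤ) × Fin 4) × Fin 3 → ℂ)
    (AdZ : ((Fin 4 → ℤ) → (MatA 2)ˣ) → (Fin 4 → ℤ) × Fin 4 → Matrix (Fin 3) (Fin 3) ℂ) (û : (Fin 4 → ℤ) → (MatA 2)ˣ)
    (hcov : ∀ (Xh : Finset (Fin 4 → ℤ)) (f : IntBondCfg) (bi bj : (Fin 4 → ℤ) × Fin 4),
      (Matrix.of fun a a' : Fin 3 => TZY Xh (intGaugeAct û f) (bi, a) (bj, a')) =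
        AdZ û bi * (Matrix.of fun a a' : Fin 3 => TZY Xh f (bi, a) (bj, a')) * (AdZ û bj)⁻¹)
    (Xh Yh : Finset (Fin 4 → ℤ)) (f : IntBondCfg) :
    twinMat F Mc TZY Xh Yh (intGaugeAct û f) =
      Matrix.blockDiagonal (fun b : ↥(twinBonds F Mc Xh) => AdZ û b.1) * twinMat F Mc TZY Xh Yh f *
        Matrix.blockDiagonal (fun b : ↥(twinBonds F Mc Xh) => (AdZ û b.1)⁻¹) := by
  classical
  ext i j
  have h := congrFun (congrFun (hcov Yh f i.2.1 j.2.1) i.1) j.1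
  simp only [Matrix.of_apply, Matrix.mul_apply] at h
  simp only [twinMat, Matrix.of_apply, Matrix.mul_apply, Matrix.blockDiagonal_apply, Fintype.sum_prod_type]
  rw [h]
  refine Finset.sum_congr rfl fun a' _ => ?_
  -- the inner sums: only the bond `j.2` (resp. `i.2`) survives
  simp only [ite_mul, zero_mul, mul_ite, mul_zero, Finset.sum_ite_eq, Finset.sum_ite_eq', Finset.mem_univ, if_true]

/-- ★ **`powTwin` IS `SL(2,ℂ)`-INVARIANT**: under (Z-cov) (blockwise covariance through invertible `AdZ û b̂`), the integer power-member formula is invariant under the pulled-back (1.10) action of every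
`SL(2,ℂ)`-valued `û` (conjugation by the invertible block-diagonal `D(û)`; ✓`powMemberPiece_conj`). [cite: Balaban1987RG1, (1.19) p.263, (1.10) p.262; Balaban1985UV3, (63) p.272] -/
theorem isGaugeInv_powTwin (Mc : ℕ)
    (TZY : Finset (Fin 4 → ℤ) → IntBondCfg → ((Fin 4 → ℤ) × Fin 4) × Fin 3 → ((Fin 4 → ℤ) × Fin 4) × Fin 3 → ℂ)
    (AdZ : ((Fin 4 → ℤ) → (MatA 2)ˣ) → (Fin 4 → ℤ) × Fin 4 → Matrix (Fin 3) (Fin 3) ℂ) (R : ℝ)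
    (hZcov : ∀ û : (Fin 4 → ℤ) → (MatA 2)ˣ, (∀ z, û z ∈ (B12RegularSpaces111SpecialUnitary.suModel 2).Gc) →
      (∀ b : (Fin 4 → ℤ) × Fin 4, IsUnit (AdZ û b)) ∧
      ∀ (Xh : Finset (Fin 4 → ℤ)) (f : IntBondCfg) (bi bj : (Fin 4 → ℤ) × Fin 4),
        (Matrix.of fun a a' : Fin 3 => TZY Xh (intGaugeAct û f) (bi, a) (bj, a')) =
          AdZ û bi * (Matrix.of fun a a' : Fin 3 => TZY Xh f (bi, a) (bj, a')) * (AdZ û bj)⁻¹) :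
    IntFormula.IsGaugeInv (powTwin F Mc TZY R) := by
  classical
  intro Xh û hû f
  obtain ⟨hunit, hcov⟩ := hZcov û hû
  show powMemberPiece _ (fun Yh : ↥Xh.powerset => twinMat F Mc TZY Xh Yh.1 (intGaugeAct û f)) R Xh =
    powMemberPiece _ (fun Yh : ↥Xh.powerset => twinMat F Mc TZY Xh Yh.1 f) R Xh
  set D : Matrix (TwinIdx F Mc Xh) (TwinIdx F Mc Xh) ℂ := Matrix.blockDiagonal fun b : ↥(twinBonds F Mc Xh) => AdZ û b.1 with hD
  set D' : Matrix (TwinIdx F Mc Xh) (TwinIdx F Mc Xh) ℂ := Matrix.blockDiagonal fun b : ↥(twinBonds F Mc Xh) => (AdZ û b.1)⁻¹ with hD'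
  have hdet : ∀ b : ↥(twinBonds F Mc Xh), IsUnit (AdZ û b.1).det := fun b => (Matrix.isUnit_iff_isUnit_det _).1 (hunit b.1)
  have hDD' : D * D' = 1 := by
    rw [hD, hD', ← Matrix.blockDiagonal_mul]
    have : (fun b : ↥(twinBonds F Mc Xh) => AdZ û b.1 * (AdZ û b.1)⁻¹) = fun _ => 1 := funext fun b => Matrix.mul_nonsing_inv _ (hdet b)
    rw [this]
    exact Matrix.blockDiagonal_one
  have hD'D : D' * D = 1 := by
    rw [hD, hD', ← Matrix.blockDiagonal_mul]
    have : (fun b : ↥(twinBonds F Mc Xh) => (AdZ û b.1)⁻¹ * AdZ û b.1) = fun _ => 1 := funext fun b => Matrix.nonsing_inv_mul _ (hdet b)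
    rw [this]
    exact Matrix.blockDiagonal_one
  have hT : (fun Yh : ↥Xh.powerset => twinMat F Mc TZY Xh Yh.1 (intGaugeAct û f)) = fun Yh => D * twinMat F Mc TZY Xh Yh.1 f * D' :=
    funext fun Yh => twinMat_intGaugeAct F Mc TZY AdZ û hcov Xh Yh.1 f
  rw [hT]
  exact powMemberPiece_conj _ hDD' hD'D _ R Xh

/-! ## §3  The bundled object -/

/-- ★ **THE INTEGER POWER-MEMBER OBJECT** `powTwinLocal … : IntLocalFormula (L^{k+1}·Mc)` — the formula `powTwin F Mc TZY R` with its window-locality ((Z-loc)) and `SL(2,ℂ)`-invariance ((Z-cov)).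
[cite: Balaban1987RG1, (1.7) p.261, (1.19) p.263, (1.21) p.264; Balaban1985UV3, (63) p.272] -/
def powTwinLocal (Mc k : ℕ)
    (TZY : Finset (Fin 4 → ℤ) → IntBondCfg → ((Fin 4 → ℤ) × Fin 4) × Fin 3 → ((Fin 4 → ℤ) × Fin 4) × Fin 3 → ℂ)
    (AdZ : ((Fin 4 → ℤ) → (MatA 2)ˣ) → (Fin 4 → ℤ) × Fin 4 → Matrix (Fin 3) (Fin 3) ℂ) (R : ℝ)
    (hZloc : ∀ i j : ((Fin 4 → ℤ) × Fin 4) × Fin 3, IntFormula.IsLocal (F.L ^ (k + 1) * Mc) fun Xh f => TZY Xh f i j)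
    (hZcov : ∀ û : (Fin 4 → ℤ) → (MatA 2)ˣ, (∀ z, û z ∈ (B12RegularSpaces111SpecialUnitary.suModel 2).Gc) →
      (∀ b : (Fin 4 → ℤ) × Fin 4, IsUnit (AdZ û b)) ∧
      ∀ (Xh : Finset (Fin 4 → ℤ)) (f : IntBondCfg) (bi bj : (Fin 4 → ℤ) × Fin 4),
        (Matrix.of fun a a' : Fin 3 => TZY Xh (intGaugeAct û f) (bi, a) (bj, a')) =
          AdZ û bi * (Matrix.of fun a a' : Fin 3 => TZY Xh f (bi, a) (bj, a')) * (AdZ û bj)⁻¹) :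
    IntLocalFormula (F.L ^ (k + 1) * Mc) :=
  ⟨powTwin F Mc TZY R, isLocal_powTwin F Mc k TZY R hZloc, isGaugeInv_powTwin F Mc TZY AdZ R hZcov⟩

/-- The formula of the bundled object is `powTwin` (`rfl`). [cite: Balaban1985UV3, (63) p.272 (bookkeeping)] -/
theorem powTwinLocal_Ψ (Mc k : ℕ)
    (TZY : Finset (Fin 4 → ℤ) → IntBondCfg → ((Fin 4 → ℤ) × Fin 4) × Fin 3 → ((Fin 4 → ℤ) × Fin 4) × Fin 3 → ℂ)
    (AdZ : ((Fin 4 → ℤ) → (MatA 2)ˣ) → (Fin 4 → ℤ) × Fin 4 → Matrix (Fin 3) (Fin 3) ℂ) (R : ℝ)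
    (hZloc : ∀ i j : ((Fin 4 → ℤ) × Fin 4) × Fin 3, IntFormula.IsLocal (F.L ^ (k + 1) * Mc) fun Xh f => TZY Xh f i j)
    (hZcov : ∀ û : (Fin 4 → ℤ) → (MatA 2)ˣ, (∀ z, û z ∈ (B12RegularSpaces111SpecialUnitary.suModel 2).Gc) →
      (∀ b : (Fin 4 → ℤ) × Fin 4, IsUnit (AdZ û b)) ∧
      ∀ (Xh : Finset (Fin 4 → ℤ)) (f : IntBondCfg) (bi bj : (Fin 4 → ℤ) × Fin 4),
        (Matrix.of fun a a' : Fin 3 => TZY Xh (intGaugeAct û f) (bi, a) (bj, a')) =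
          AdZ û bi * (Matrix.of fun a a' : Fin 3 => TZY Xh f (bi, a) (bj, a')) * (AdZ û bj)⁻¹) :
    (powTwinLocal F Mc k TZY AdZ R hZloc hZcov).Ψ = powTwin F Mc TZY R := rfl

end Summit.QuantumFields.YangMills.Theorems.BalabanUVNodesPortS1

end
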